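import Summits.AtomisticToContinuum.FouriersLaw.Theorems.VanishingNoiseTransferNoiseLocalityStubResponseDensityNoisyAux7
import Summits.AtomisticToContinuum.FouriersLaw.Theorems.OddSectorIrreversibilityOddDensityIsCorrectorDetailedBalance
import Summits.AtomisticToContinuum.FouriersLaw.Theorems.OddSectorIrreversibilityOddResponseBoundDensityUnique

/-!
# Duhamel flip bound, part 2: weak solutions of the equilibrium generator are strong
(graph closure of `L_{T,T}` on test functions; helper for stub `stub_duhamelFlipBound`)

Helper file `--supports stmt-AtomisticToContinuum-11975` (crux `NoiseLocality`, route
`VanishingNoiseTransfer`, line `relative-flip-energy-transfer`, stub 2 `stub_duhamelFlipBound`).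

**Theorem (`integral_eq_of_weak_pair`).** Pinned anharmonic chain, all parameters `> 0` (`lam, β ≥ 0`
suffice), `N ≥ 2`, `T > 0`, `μ_T` the Gibbs measure, `L = L_{T,T}` the equilibrium generator,
`Θ(q,p) = (q,-p)`. Let `u, v ∈ L²(μ_T)` be a WEAK SOLUTION PAIR of `L u = v`, i.e.
`∫ (L g) · (u∘Θ) dμ_T = ∫ g · (v∘Θ) dμ_T` for all `g ∈ C_c^∞` (by the generator-level detailed balance
`L† = ΘLΘ` this says `⟨L† g', u⟩ = ⟨g', v⟩` for all test `g'`). Then `(u, v)` lies in the graph closure of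
`L|C_c^∞` in `L²(μ_T) × L²(μ_T)`; in the tested form proved here: for all `w₁, w₂ ∈ L²(μ_T)` with
`∫ (L F) w₁ dμ_T = ∫ F w₂ dμ_T` for every `F ∈ C_c^∞`, also `∫ v w₁ dμ_T = ∫ u w₂ dμ_T`.

Proof, in `H = L²(μ_T)` with the tree's essential m-dissipativity of `L` on test functions: by the
dense range of `(1 - L)C_c^∞` (`exists_testFunction_resolvent_approx`) pick test functions `F_n` with
`F_n - LF_n → u - v`; the lower bound `‖F‖ ≤ ‖F - LF‖` (`resolvent_lower_bound`) makes `F_n` Cauchy,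
`F_n → x`, `LF_n → x - (u - v)`. For a test `g`, `⟨F_n, (g - Lg)∘Θ⟩ = ⟨F_n - LF_n, g∘Θ⟩`
(`L† = ΘLΘ`, `pinnedChain_integral_generator_mul_gibbsMeasure_eq_reversal`), and the weak equation gives
`⟨u, (g - Lg)∘Θ⟩ = ⟨u - v, g∘Θ⟩`; so `(x - u)∘Θ ⊥ (1 - L)C_c^∞`, whence `x = u`
(`ae_eq_zero_of_weak_resolvent`). Thus `F_n → u`, `LF_n → v`, and the tested relation passes to the
limit. No definitions.
-/

noncomputable section

open MeasureTheory Filter Topology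
open scoped ContDiff InnerProductSpace

namespace Summit.AtomisticToContinuum.FouriersLaw.Theorems.NoiseLocality.StubDuhamelFlipBound

open Literature.MathematicalPhysics.KineticTheory.HeatConduction
open Summit.AtomisticToContinuum.FouriersLaw.Theorems.OddSectorIrreversibility
open Summit.AtomisticToContinuum.FouriersLaw.Theorems.NoiseLocality.StubResponseDensityNoisy

variable {ω₂ lam β γ : ℝ} {N : ℕ} {T : ℝ}

/-- `g ∘ Θ` is continuous with compact support, hence in `L²` of a finite measure, for a test
function `g` (`Θ(q,p) = (q,-p)`). -/
theorem memLp_comp_reversal_of_test {g : PhaseSpace N → ℝ} (hg : Continuous g)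
    (hgc : HasCompactSupport g) (μ : Measure (PhaseSpace N)) [IsFiniteMeasure μ] :
    MemLp (fun x : PhaseSpace N => g (x.1, -x.2)) 2 μ := by
  have hc : Continuous fun x : PhaseSpace N => g (x.1, -x.2) :=
    hg.comp (continuous_fst.prodMk continuous_snd.neg)
  have hs : HasCompactSupport fun x : PhaseSpace N => g (x.1, -x.2) := by
    have e : (fun y : PhaseSpace N => g (y.1, -y.2)) = g ∘ (momentumReversal N) := by
      funext y; simp
    rw [e]
    exact hgc.comp_homeomorph ((Homeomorph.refl (Fin N → ℝ)).prodCongr (Homeomorph.neg (Fin N → ℝ)))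
  exact memLp_of_continuous_hasCompactSupport hc hs μ 2

/-- **Weak solution pairs of the equilibrium generator are in its graph closure (tested form).**
See the module docstring. -/
theorem integral_eq_of_weak_pair (hω : 0 < ω₂) (hl : 0 ≤ lam) (hβ : 0 ≤ β) (hγ : 0 < γ)
    (hN : 2 ≤ N) (hT : 0 < T) {u v : PhaseSpace N → ℝ}
    (hu : MemLp u 2 ((pinnedChain ω₂ lam β γ).gibbsMeasure N T))
    (hv : MemLp v 2 ((pinnedChain ω₂ lam β γ).gibbsMeasure N T))
    (huv : ∀ g : PhaseSpace N → ℝ, ContDiff ℝ ∞ g → HasCompactSupport g →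
      ∫ x, (pinnedChain ω₂ lam β γ).generator N T T g x * u (x.1, -x.2)
          ∂((pinnedChain ω₂ lam β γ).gibbsMeasure N T) =
        ∫ x, g x * v (x.1, -x.2) ∂((pinnedChain ω₂ lam β γ).gibbsMeasure N T))
    {w₁ w₂ : PhaseSpace N → ℝ}
    (hw₁ : MemLp w₁ 2 ((pinnedChain ω₂ lam β γ).gibbsMeasure N T))
    (hw₂ : MemLp w₂ 2 ((pinnedChain ω₂ lam β γ).gibbsMeasure N T))
    (hw : ∀ F : PhaseSpace N → ℝ, ContDiff ℝ ∞ F → HasCompactSupport F →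
      ∫ x, (pinnedChain ω₂ lam β γ).generator N T T F x * w₁ x
          ∂((pinnedChain ω₂ lam β γ).gibbsMeasure N T) =
        ∫ x, F x * w₂ x ∂((pinnedChain ω₂ lam β γ).gibbsMeasure N T)) :
    ∫ x, v x * w₁ x ∂((pinnedChain ω₂ lam β γ).gibbsMeasure N T) =
      ∫ x, u x * w₂ x ∂((pinnedChain ω₂ lam β γ).gibbsMeasure N T) := by
  classical
  set P := pinnedChain ω₂ lam β γ with hP
  set π := P.gibbsMeasure N T with hπ_def
  haveI hprob : IsProbabilityMeasure π := pinnedChain_isProbabilityMeasure_gibbsMeasure hω hl hβ γ N hT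
  have hU1 := pinnedChain_contDiff_U ω₂ lam β γ (n := 1)
  have hV1 := pinnedChain_contDiff_V ω₂ lam β γ (n := 1)
  have hΘ : MeasurePreserving (momentumReversal N) π π :=
    OddResponseBound.DensityUnique.measurePreserving_momentumReversal_gibbsMeasure P N T
  -- (a) approximants `F n - L F n → u - v`
  have hy : MemLp (fun x => u x - v x) 2 π := hu.sub hv
  have happrox : ∀ n : ℕ, ∃ F : PhaseSpace N → ℝ, ContDiff ℝ ∞ F ∧ HasCompactSupport F ∧
      ∫ x, ((u x - v x) - (1 * F x - P.generator N T T F x)) ^ 2 ∂π ≤ (1 / ((n : ℝ) + 1)) ^ 2 :=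
    fun n => exists_testFunction_resolvent_approx hω hl hβ hγ hN hT one_pos hy (by positivity)
  choose F hFs hFc hFa using happrox
  have hF2 : ∀ n, ContDiff ℝ 2 (F n) := fun n => (hFs n).of_le (by norm_cast)
  have hFm : ∀ n, MemLp (F n) 2 π := fun n =>
    memLp_of_continuous_hasCompactSupport (hFs n).continuous (hFc n) π 2
  have hLm : ∀ n, MemLp (P.generator N T T (F n)) 2 π := fun n =>
    memLp_of_continuous_hasCompactSupport (P.continuous_generator hU1 hV1 N T T (hF2 n))
      (P.hasCompactSupport_generator N T T (hF2 n) (hFc n)) π 2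
  have hRm : ∀ n, MemLp (fun x => 1 * F n x - P.generator N T T (F n) x) 2 π := fun n =>
    ((hFm n).const_mul 1).sub (hLm n)
  set φ : ℕ → Lp ℝ 2 π := fun n => (hFm n).toLp (F n) with hφ_def
  set ψ : ℕ → Lp ℝ 2 π := fun n => (hRm n).toLp _ with hψ_def
  set Λ : ℕ → Lp ℝ 2 π := fun n => (hLm n).toLp _ with hΛ_def
  set yv : Lp ℝ 2 π := hy.toLp _ with hyv_def
  set uv : Lp ℝ 2 π := hu.toLp u with huv_def
  set vv : Lp ℝ 2 π := hv.toLp v with hvv_def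
  -- `ψ n → yv`
  have hψ : Tendsto ψ atTop (𝓝 yv) := by
    rw [tendsto_iff_norm_sub_tendsto_zero]
    have hbd : ∀ n, ‖ψ n - yv‖ ≤ 1 / ((n : ℝ) + 1) := by
      intro n
      have hsub : MemLp (fun x => (1 * F n x - P.generator N T T (F n) x) - (u x - v x)) 2 π :=
        (hRm n).sub hy
      have e : ψ n - yv = hsub.toLp _ := (MemLp.toLp_sub (hRm n) hy).symm
      rw [e, norm_toLp_eq_sqrt]
      calc Real.sqrt (∫ x, ((1 * F n x - P.generator N T T (F n) x) - (u x - v x)) ^ 2 ∂π)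
          = Real.sqrt (∫ x, ((u x - v x) - (1 * F n x - P.generator N T T (F n) x)) ^ 2 ∂π) := by
            congr 1
            exact integral_congr_ae (Eventually.of_forall fun x => by ring)
        _ ≤ Real.sqrt ((1 / ((n : ℝ) + 1)) ^ 2) := Real.sqrt_le_sqrt (hFa n)
        _ = 1 / ((n : ℝ) + 1) := Real.sqrt_sq (by positivity)
    exact squeeze_zero (fun n => norm_nonneg _) hbd tendsto_one_div_add_atTop_nhds_zero_nat
  -- lower bound ⇒ `φ` Cauchy
  have hlow : ∀ n m, ‖φ n - φ m‖ ≤ ‖ψ n - ψ m‖ := by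
    intro n m
    have hFnm : ContDiff ℝ ∞ (fun x => F n x - F m x) := (hFs n).sub (hFs m)
    have hFnmc : HasCompactSupport (fun x => F n x - F m x) := (hFc n).sub (hFc m)
    have hsubm : MemLp (fun x => F n x - F m x) 2 π := (hFm n).sub (hFm m)
    have hRsub : MemLp (fun x => 1 * (F n x - F m x) -
        P.generator N T T (fun y => F n y - F m y) x) 2 π := by
      refine ((hRm n).sub (hRm m)).ae_eq (Eventually.of_forall fun x => ?_)
      simp only [Pi.sub_apply]
      rw [generator_sub P N T T (hF2 n) (hF2 m) x]
      ring
    have h := resolvent_lower_bound hω hl hβ hγ hT 1 hFnm hFnmc hsubm hRsub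
    have e1 : hsubm.toLp _ = φ n - φ m := MemLp.toLp_sub (hFm n) (hFm m)
    have e2 : hRsub.toLp _ = ψ n - ψ m := by
      rw [hψ_def, ← MemLp.toLp_sub]
      refine MemLp.toLp_congr _ _ (Eventually.of_forall fun x => ?_)
      simp only [Pi.sub_apply]
      rw [generator_sub P N T T (hF2 n) (hF2 m) x]
      ring
    rw [e1, e2, one_mul] at h
    exact h
  have hφc : CauchySeq φ := by
    have hψc : CauchySeq ψ := hψ.cauchySeq
    rw [Metric.cauchySeq_iff] at hψc ⊢
    intro e he
    obtain ⟨M, hM⟩ := hψc e he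
    refine ⟨M, fun n hn m hm => ?_⟩
    have h2 := hM n hn m hm
    rw [dist_eq_norm] at h2 ⊢
    exact (hlow n m).trans_lt h2
  obtain ⟨xv, hx⟩ := cauchySeq_tendsto_of_complete hφc
  -- `Λ n = φ n - ψ n`
  have hΛ : ∀ n, Λ n = φ n - ψ n := by
    intro n
    rw [hΛ_def, hφ_def, hψ_def, ← MemLp.toLp_sub]
    exact MemLp.toLp_congr _ _ (Eventually.of_forall fun x => by
      simp only [Pi.sub_apply]
      ring)
  -- (b) identification of the limit: `xv = uv`
  have hid : ∀ g : PhaseSpace N → ℝ, ContDiff ℝ ∞ g → HasCompactSupport g →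
      ∫ x, (xv : PhaseSpace N → ℝ) x * (g (x.1, -x.2) - P.generator N T T g (x.1, -x.2)) ∂π =
        ∫ x, u x * (g (x.1, -x.2) - P.generator N T T g (x.1, -x.2)) ∂π := by
    intro g hg hgc
    have hg2 : ContDiff ℝ 2 g := hg.of_le (by norm_cast)
    have hLgc : Continuous (P.generator N T T g) := P.continuous_generator hU1 hV1 N T T hg2
    have hLgs : HasCompactSupport (P.generator N T T g) := P.hasCompactSupport_generator N T T hg2 hgc
    -- the test vectors `a = g∘Θ`, `b = (g - Lg)∘Θ`
    have ham : MemLp (fun x : PhaseSpace N => g (x.1, -x.2)) 2 π :=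
      memLp_comp_reversal_of_test hg.continuous hgc π
    have hbm : MemLp (fun x : PhaseSpace N => g (x.1, -x.2) - P.generator N T T g (x.1, -x.2)) 2 π :=
      ham.sub (memLp_comp_reversal_of_test hLgc hLgs π)
    set av : Lp ℝ 2 π := ham.toLp _ with hav_def
    set bv : Lp ℝ 2 π := hbm.toLp _ with hbv_def
    -- `⟨φ n, b⟩ = ⟨ψ n, a⟩`
    have hstep : ∀ n, ⟪φ n, bv⟫_ℝ = ⟪ψ n, av⟫_ℝ := by
      intro n
      rw [hφ_def, hψ_def, inner_toLp_toLp_eq_integral, inner_toLp_toLp_eq_integral]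
      have hrev := pinnedChain_integral_generator_mul_gibbsMeasure_eq_reversal ω₂ lam β γ N hT.ne'
        (hF2 n) (hFc n) (k := fun y : PhaseSpace N => g (y.1, -y.2))
        ((hg2.comp (contDiff_fst.prodMk contDiff_snd.neg)))
      have ek : (fun y : PhaseSpace N => (fun y : PhaseSpace N => g (y.1, -y.2)) (y.1, -y.2)) = g := by
        funext y; simp
      rw [ek] at hrev
      have i1 : Integrable (fun x => F n x * g (x.1, -x.2)) π := (hFm n).integrable_mul ham
      have i2 : Integrable (fun x => F n x * P.generator N T T g (x.1, -x.2)) π :=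
        (hFm n).integrable_mul (memLp_comp_reversal_of_test hLgc hLgs π)
      have i3 : Integrable (fun x => P.generator N T T (F n) x * g (x.1, -x.2)) π :=
        (hLm n).integrable_mul ham
      calc ∫ x, F n x * (g (x.1, -x.2) - P.generator N T T g (x.1, -x.2)) ∂π
          = (∫ x, F n x * g (x.1, -x.2) ∂π) - ∫ x, F n x * P.generator N T T g (x.1, -x.2) ∂π := by
            rw [← integral_sub i1 i2]
            exact integral_congr_ae (Eventually.of_forall fun x => by ring)
        _ = (∫ x, F n x * g (x.1, -x.2) ∂π) - ∫ x, P.generator N T T (F n) x * g (x.1, -x.2) ∂π := by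
            rw [hrev]
        _ = ∫ x, (1 * F n x - P.generator N T T (F n) x) * g (x.1, -x.2) ∂π := by
            rw [← integral_sub i1 i3]
            exact integral_congr_ae (Eventually.of_forall fun x => by ring)
    have hlim1 : ⟪xv, bv⟫_ℝ = ⟪yv, av⟫_ℝ :=
      tendsto_nhds_unique (hx.inner tendsto_const_nhds)
        ((hψ.inner tendsto_const_nhds).congr fun n => (hstep n).symm)
    -- the weak equation: `⟨u, b⟩ = ⟨u - v, a⟩`
    have hweak : ∫ x, u x * (g (x.1, -x.2) - P.generator N T T g (x.1, -x.2)) ∂π =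
        ∫ x, (u x - v x) * g (x.1, -x.2) ∂π := by
      have h0 := huv g hg hgc
      -- change variables `x ↦ Θx` in the weak equation
      have h1 := integral_comp_reversal_gibbsMeasure P N T
        (fun x => P.generator N T T g x * u (x.1, -x.2))
      have h2 := integral_comp_reversal_gibbsMeasure P N T (fun x => g x * v (x.1, -x.2))
      simp only [neg_neg, Prod.mk.eta] at h1 h2
      rw [← hπ_def] at h1 h2
      have h3 : ∫ x, P.generator N T T g (x.1, -x.2) * u x ∂π = ∫ x, g (x.1, -x.2) * v x ∂π := by
        rw [h1, h2]; exact h0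
      have i1 : Integrable (fun x => u x * g (x.1, -x.2)) π := hu.integrable_mul ham
      have i2 : Integrable (fun x => u x * P.generator N T T g (x.1, -x.2)) π :=
        hu.integrable_mul (memLp_comp_reversal_of_test hLgc hLgs π)
      have i3 : Integrable (fun x => v x * g (x.1, -x.2)) π := hv.integrable_mul ham
      calc ∫ x, u x * (g (x.1, -x.2) - P.generator N T T g (x.1, -x.2)) ∂π
          = (∫ x, u x * g (x.1, -x.2) ∂π) - ∫ x, u x * P.generator N T T g (x.1, -x.2) ∂π := by
            rw [← integral_sub i1 i2]
            exact integral_congr_ae (Eventually.of_forall fun x => by ring)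
        _ = (∫ x, u x * g (x.1, -x.2) ∂π) - ∫ x, v x * g (x.1, -x.2) ∂π := by
            congr 1
            calc ∫ x, u x * P.generator N T T g (x.1, -x.2) ∂π
                = ∫ x, P.generator N T T g (x.1, -x.2) * u x ∂π :=
                  integral_congr_ae (Eventually.of_forall fun x => by ring)
              _ = ∫ x, g (x.1, -x.2) * v x ∂π := h3
              _ = ∫ x, v x * g (x.1, -x.2) ∂π := integral_congr_ae (Eventually.of_forall fun x => by ring)
        _ = ∫ x, (u x - v x) * g (x.1, -x.2) ∂π := by
            rw [← integral_sub i1 i3]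
            exact integral_congr_ae (Eventually.of_forall fun x => by ring)
    have e1 : ⟪xv, bv⟫_ℝ = ∫ x, (xv : PhaseSpace N → ℝ) x *
        (g (x.1, -x.2) - P.generator N T T g (x.1, -x.2)) ∂π := by
      rw [hbv_def, inner_toLp_eq_integral]
    have e2 : ⟪yv, av⟫_ℝ = ∫ x, (u x - v x) * g (x.1, -x.2) ∂π := by
      rw [hyv_def, hav_def, inner_toLp_toLp_eq_integral]
    rw [← e1, hlim1, e2, hweak]
  have hxu : xv = uv := by
    -- a measurable representative of `xv - uv`
    have hdm : MemLp (fun x => (xv : PhaseSpace N → ℝ) x - u x) 2 π := (Lp.memLp xv).sub hu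
    set k : PhaseSpace N → ℝ := hdm.1.mk _ with hk
    have hkm : Measurable k := hdm.1.stronglyMeasurable_mk.measurable
    have hdk : (fun x => (xv : PhaseSpace N → ℝ) x - u x) =ᵐ[π] k := hdm.1.ae_eq_mk
    have hkL : MemLp k 2 π := hdm.ae_eq hdk
    -- `k∘Θ` is orthogonal to `(1 - L)C_c^∞`
    have hkΘm : Measurable fun x : PhaseSpace N => k (x.1, -x.2) := hkm.comp (momentumReversal N).measurable
    have hkΘL : MemLp (fun x : PhaseSpace N => k (x.1, -x.2)) 2 π := hkL.comp_measurePreserving hΘ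
    have hkw : ∀ G : PhaseSpace N → ℝ, ContDiff ℝ ∞ G → HasCompactSupport G →
        ∫ x, (1 * G x - P.generator N T T G x) * k (x.1, -x.2) ∂π = 0 := by
      intro G hG hGc
      have hG2 : ContDiff ℝ 2 G := hG.of_le (by norm_cast)
      have hLGc : Continuous (P.generator N T T G) := P.continuous_generator hU1 hV1 N T T hG2
      have hLGs : HasCompactSupport (P.generator N T T G) := P.hasCompactSupport_generator N T T hG2 hGc
      have hbm : MemLp (fun x : PhaseSpace N => G (x.1, -x.2) - P.generator N T T G (x.1, -x.2)) 2 π :=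
        (memLp_comp_reversal_of_test hG.continuous hGc π).sub (memLp_comp_reversal_of_test hLGc hLGs π)
      have h1 := hid G hG hGc
      have i1 : Integrable (fun x => (xv : PhaseSpace N → ℝ) x *
          (G (x.1, -x.2) - P.generator N T T G (x.1, -x.2))) π := (Lp.memLp xv).integrable_mul hbm
      have i2 : Integrable (fun x => u x * (G (x.1, -x.2) - P.generator N T T G (x.1, -x.2))) π :=
        hu.integrable_mul hbm
      have h2 : ∫ x, k x * (G (x.1, -x.2) - P.generator N T T G (x.1, -x.2)) ∂π = 0 := by
        have e : ∫ x, k x * (G (x.1, -x.2) - P.generator N T T G (x.1, -x.2)) ∂π =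
            ∫ x, ((xv : PhaseSpace N → ℝ) x - u x) * (G (x.1, -x.2) - P.generator N T T G (x.1, -x.2)) ∂π := by
          refine integral_congr_ae ?_
          filter_upwards [hdk] with x hx
          rw [← hx]
        rw [e]
        have e2 : ∫ x, ((xv : PhaseSpace N → ℝ) x - u x) *
            (G (x.1, -x.2) - P.generator N T T G (x.1, -x.2)) ∂π =
            (∫ x, (xv : PhaseSpace N → ℝ) x * (G (x.1, -x.2) - P.generator N T T G (x.1, -x.2)) ∂π) -
              ∫ x, u x * (G (x.1, -x.2) - P.generator N T T G (x.1, -x.2)) ∂π := by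
          rw [← integral_sub i1 i2]
          exact integral_congr_ae (Eventually.of_forall fun x => by ring)
        rw [e2, h1, sub_self]
      -- change variables
      have h3 := integral_comp_reversal_gibbsMeasure P N T
        (fun x => k x * (G (x.1, -x.2) - P.generator N T T G (x.1, -x.2)))
      simp only [neg_neg, Prod.mk.eta] at h3
      rw [← hπ_def, h2] at h3
      rw [← h3]
      exact integral_congr_ae (Eventually.of_forall fun x => by ring)
    have hk0 := ae_eq_zero_of_weak_resolvent hω hl hβ hγ hN hT one_pos hkΘm hkΘL hkw
    -- back from `k∘Θ` to `k`
    have hk0' : k =ᵐ[π] 0 := by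
      have h := hΘ.quasiMeasurePreserving.ae_eq_comp hk0
      filter_upwards [h] with x hx
      simpa using hx
    have hd0 : (fun x => (xv : PhaseSpace N → ℝ) x - u x) =ᵐ[π] 0 := hdk.trans hk0'
    have hsub : xv - uv = 0 := by
      rw [Lp.eq_zero_iff_ae_eq_zero]
      have h2 : (uv : PhaseSpace N → ℝ) =ᵐ[π] u := by
        rw [huv_def]
        exact MemLp.coeFn_toLp hu
      filter_upwards [Lp.coeFn_sub xv uv, h2, hd0] with x hx1 hx2 hx3
      rw [hx1, Pi.sub_apply, hx2]
      exact hx3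
    exact sub_eq_zero.1 hsub
  -- (c) `φ n → uv`, `Λ n → vv`
  have hφ : Tendsto φ atTop (𝓝 uv) := hxu ▸ hx
  have hyuv : yv = uv - vv := by
    rw [hyv_def, huv_def, hvv_def, ← MemLp.toLp_sub]
    rfl
  have hΛlim : Tendsto Λ atTop (𝓝 vv) := by
    have h := hφ.sub hψ
    rw [hyuv, sub_sub_cancel] at h
    exact h.congr fun n => (hΛ n).symm
  -- (d) the tested relation passes to the limit
  set W₁ : Lp ℝ 2 π := hw₁.toLp w₁ with hW₁_def
  set W₂ : Lp ℝ 2 π := hw₂.toLp w₂ with hW₂_def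
  have hn : ∀ n, ⟪Λ n, W₁⟫_ℝ = ⟪φ n, W₂⟫_ℝ := by
    intro n
    rw [hΛ_def, hφ_def, hW₁_def, hW₂_def, inner_toLp_toLp_eq_integral, inner_toLp_toLp_eq_integral]
    exact hw (F n) (hFs n) (hFc n)
  have hlim : ⟪vv, W₁⟫_ℝ = ⟪uv, W₂⟫_ℝ :=
    tendsto_nhds_unique ((hΛlim.inner tendsto_const_nhds).congr fun n => hn n)
      (hφ.inner tendsto_const_nhds)
  rw [hvv_def, huv_def, hW₁_def, hW₂_def, inner_toLp_toLp_eq_integral, inner_toLp_toLp_eq_integral] at hlim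
  exact hlim

/-! ### Registered helper sub-goal (stub form, one line) -/

/-- Registered helper sub-goal `helper_duhamelWeakPairClosure` of stub `stub_duhamelFlipBound`
(= `integral_eq_of_weak_pair` in stub form): weak solution pairs of the equilibrium generator are in its
graph closure, tested form. -/
theorem helper_duhamelWeakPairClosure : ∀ ω₂ lam β γ : ℝ, 0 < ω₂ → 0 ≤ lam → 0 ≤ β → 0 < γ → ∀ (N : ℕ), 2 ≤ N → ∀ (T : ℝ), 0 < T → ∀ u v : Literature.MathematicalPhysics.KineticTheory.HeatConduction.PhaseSpace N → ℝ, MeasureTheory.MemLp u 2 ((Literature.MathematicalPhysics.KineticTheory.HeatConduction.pinnedChain ω₂ lam β γ).gibbsMeasure N T) → MeasureTheory.MemLp v 2 ((Literature.MathematicalPhysics.KineticTheory.HeatConduction.pinnedChain ω₂ lam β γ).gibbsMeasure N T) → (∀ g : Literature.MathematicalPhysics.KineticTheory.HeatConduction.PhaseSpace N → ℝ, ContDiff ℝ ((⊤ : ℕ∞) : WithTop ℕ∞) g → HasCompactSupport g → ∫ x, (Literature.MathematicalPhysics.KineticTheory.HeatConduction.pinnedChain ω₂ lam β γ).generator N T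 T g x * u (x.1, -x.2) ∂((Literature.MathematicalPhysics.KineticTheory.HeatConduction.pinnedChain ω₂ lam β γ).gibbsMeasure N T) = ∫ x, g x * v (x.1, -x.2) ∂((Literature.MathematicalPhysics.KineticTheory.HeatConduction.pinnedChain ω₂ lam β γ).gibbsMeasure N T)) → ∀ w₁ w₂ : Literature.MathematicalPhysics.KineticTheory.HeatConduction.PhaseSpace N → ℝ, MeasureTheory.MemLp w₁ 2 ((Literature.MathematicalPhysics.KineticTheory.HeatConduction.pinnedChain ω₂ lam β γ).gibbsMeasure N T) → MeasureTheory.MemLp w₂ 2 ((Literature.MathematicalPhysics.KineticTheory.HeatConduction.pinnedChain ω₂ lam β γ).gibbsMeasure N T) → (∀ F : Literature.MathematicalPhysics.KineticTheory.HeatConduction.PhaseSpace N → ℝ, ContDiff ℝ ((⊤ : ℕ∞) : WithTop ℕ∞) F → HasCompactSupport F → ∫ x, (Literature.MathematicalPhysics.KineticTheory.HeatConduction.pinnedChain ω₂ lam β γ).generator N T T F x * w₁ x ∂((Literature.MathematicalPhysics.KineticTheory.HeatConduction.pinnedChain ω₂ lam β γ).gibbsMeasure N T) = ∫ x, F x *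 w₂ x ∂((Literature.MathematicalPhysics.KineticTheory.HeatConduction.pinnedChain ω₂ lam β γ).gibbsMeasure N T)) → ∫ x, v x * w₁ x ∂((Literature.MathematicalPhysics.KineticTheory.HeatConduction.pinnedChain ω₂ lam β γ).gibbsMeasure N T) = ∫ x, u x * w₂ x ∂((Literature.MathematicalPhysics.KineticTheory.HeatConduction.pinnedChain ω₂ lam β γ).gibbsMeasure N T) :=
  fun _ _ _ _ hω hl hβ hγ _ hN _ hT _ _ hu hv huv _ _ hw₁ hw₂ hw =>
    integral_eq_of_weak_pair hω hl hβ hγ hN hT hu hv huv hw₁ hw₂ hw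

end Summit.AtomisticToContinuum.FouriersLaw.Theorems.NoiseLocality.StubDuhamelFlipBound

end
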